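import Summits.BirchSwinnertonDyer.BirchSwinnertonDyer.Theorems.CMKolyvaginAtInertTwoPairMemberCanonicalKolAtTwo
import HarnessLib

/-!
# Route `CMKolyvaginAtInertTwo`, crux `CMKolyvaginExactAtInertTwo` (stmt-BirchSwinnertonDyer-24277):
# the member formulas of the twin `E^{(d_K)}` (Lemma 5.3, Prop. 4.7, canonical composition), DEPTH PARITIES GENERIC

Seat `bsd-line-cmk2-p1` g17 (cell `bsd-print-cf2`); helper (`--supports stmt-BirchSwinnertonDyer-24277`).
THEOREMS ONLY: no definition, no named fact, no `sorry`; no item is closed; BSD is not proved by this.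
WHY. The landed `hloc₂_canonical_of_rel_of_kol` / `hV₂_of_localTerm_of_kol` / `hV₂_canonical_of_kol` hard-wire
"classes of `E^{(d_K)}` at ODD depth": the branch `ε(E/ℚ) = -1`. The crux's hypotheses allow `ε(E/ℚ) = +1` too
(`y_K` non-torsion only forces `ε(E/K) = -1`): then `y_K`'s class is `τ`-anti-invariant, descends to
`H¹(ℚ, E^{(d_K)}[2^M])`, the twin holds `x` (slot `V₁` of `PairDataM`) at EVEN depth. The proofs use the parities
only through the displayed Lemma 4.3 / Prop. 4.4 hypotheses and `|ℓm'| = |m'| + 1`, so they are re-run VERBATIM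
with free predicates `Par₁` (depths of the classes of `E`), `Par₂` (of the twin) and the link `hPar`.
`(Even, Odd)` = the landed theorems; `(Odd, Even)` = the input of slot `V₁ := H¹(ℚ, E^{(d_K)}[2^{2L}])` in
`card_mul_card_le_two_pow_two_mul_of_pairData` (p717813, generic in `V₁, V₂`).
* `hloc₂_canonical_of_rel_of_par`, `hV₂_of_localTerm_of_par`, `hV₂_canonical_of_par`.
References: [McCallumLMS1991] §4 Prop. 4.4, 4.7, §5 Lemma 5.3, Thm. 5.4; [MilneADT2006] I Thm. 4.10, §6 Prop. 6.9;
[GrossDurham1991] §3 and [Kolyvagin1989Izv] §3 (the sign `τ y_n = -ε (-1)^{|n|} y_n` deciding the branch).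
-/

set_option linter.dupNamespace false -- tree convention: `Summit.BirchSwinnertonDyer.BirchSwinnertonDyer.Theorems` (summit = sub-problem)
set_option autoImplicit false

noncomputable section

open scoped Classical AddSubgroup

namespace Summit.BirchSwinnertonDyer.BirchSwinnertonDyer.Theorems.KolyvaginPairDataTwo

open WeierstrassCurve NumberField IsDedekindDomain Field Function Rat.HeightOneSpectrum Literature.GroupTheory.FiniteAbelian
open Literature.NumberTheory.EllipticCurves Literature.NumberTheory.GaloisRepresentations Literature.NumberTheory.GaloisCohomology
open Literature.NumberTheory.GaloisRepresentations.DiscreteGaloisModule (mu)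
open Literature.NumberTheory.EllipticCurves.KolyvaginDescent Summit.BirchSwinnertonDyer.BirchSwinnertonDyer.Theorems.GenusExact.ReductionCyclic
open Summit.BirchSwinnertonDyer.BirchSwinnertonDyer.Theorems.GenusExact.VisiblePairAtTwo

section ParMemberTwo

variable {W : WeierstrassCurve ℚ} [W.IsElliptic] [W.IsGloballyMinimal] {K : Type} [Field K] [NumberField K]
  {L : ℕ} [(twin W K).IsElliptic]

/-- **`hloc₂` (McCallum's Lemma 5.3, local term at `λ` of the member `E^{(d_K)}`), depth parity generic**: `hloc₂_canonical_of_rel_of_kol`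
with the parity `Even |m'|` of the other member's depth replaced by a free predicate `Par₁`; proof verbatim.
[cite: McCallumLMS1991, §4 Prop. 4.4 and Prop. 4.7, §5 Lemma 5.3, Thm. 5.4 (proof)] [cite: MilneADT2006, Ch. I §6, proof of Prop. 6.9] -/
theorem hloc₂_canonical_of_rel_of_par {M₀ : ℕ} (c₁ : ℕ → galH1Torsion W (lvl (L + L)))
    (c₂ : ℕ → galH1Torsion (twin W K) (lvl (L + L))) (hK : IsImaginaryQuadratic K)
    (hoddK : Odd (NumberField.discr K)) (hΔ : W.Δ < 0) (hL : M₀ ≤ L) (hL1 : 1 ≤ L)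
    (Kol : ℕ → Prop) (hKol : ∀ ℓ, Kol ℓ → kolPrime W K (L + L) ℓ)
    (Par₁ : ℕ → Prop)
    -- McCallum's Prop. 4.4 ACROSS the members, even depth `m'` to odd depth `ℓm'`
    (h44₁₂ : ∀ ℓ m : ℕ, Kol ℓ → KolSupp Kol (ℓ * m) →
      Par₁ m → ∀ a : ℕ,
        ((2 : ℤ) ^ a) • c₂ (ℓ * m) ∈ loc₂ W K (L + L) (pl ℓ) ↔ ((2 : ℤ) ^ a) • c₁ m ∈ a₁ W (L + L) ℓ)
    (e : geomTorsion (twin W K) ((2 ^ L * 2 ^ L : ℕ) : ℤ) → geomTorsion (twin W K) ((2 ^ L * 2 ^ L : ℕ) : ℤ) →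
      AlgebraicClosure ℚ)
    (hμ : ∀ S T, e S T ^ (2 ^ L * 2 ^ L) = 1)
    (hadd₁ : ∀ S₁ S₂ T, e (S₁ + S₂) T = e S₁ T * e S₂ T)
    (hadd₂ : ∀ S T₁ T₂, e S (T₁ + T₂) = e S T₁ * e S T₂)
    (hgal : ∀ (σ : absoluteGaloisGroup ℚ) (S T : geomTorsion (twin W K) ((2 ^ L * 2 ^ L : ℕ) : ℤ)),
      σ • e S T = e (σ • S) (σ • T))
    (halt : ∀ T, e T T = 1) (hnondeg : ∀ T, (∀ S, e S T = 1) → T = 0) :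
    ∀ ℓ m' : ℕ, (hℓ : Kol ℓ) → KolSupp Kol (ℓ * m') → ¬ ℓ ∣ m' →
      Par₁ m' →
      ∀ (j N a b : ℕ) (t : galH1Torsion (twin W K) (lvl (L + L))), t ∈ selmerGroup (twin W K) (lvl (L + L)) →
      ((2 : ℤ) ^ j) • c₂ (ℓ * m') ∈ selmerGroup (twin W K) (lvl (L + L)) →
      ((2 : ℤ) ^ N) • t = 0 → ((2 : ℤ) ^ L) • t = 0 →
      (∀ q ∈ m'.primeFactors, t ∈ a₂ W K (L + L) q) → L + L - M₀ ≤ j → N + M₀ ≤ L + L → N ≤ j →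
      a + b + 1 = N → ((2 : ℤ) ^ (a + (j - N))) • c₁ m' ∉ a₁ W (L + L) ℓ →
      ((2 : ℤ) ^ b) • t ∉ a₂ W K (L + L) ℓ →
      ∀ D : FirstCaseData (twin W K) (2 ^ L),
        D.b₁ = torsionH1OfDvd (twin W K) (lvl_dvd_sq L) (((2 : ℤ) ^ (j - L)) • c₂ (ℓ * m')) →
        galoisCohomology.map (inclKD (twin W K) (2 ^ L) (2 ^ L)) 1 D.b' =
          torsionH1OfDvd (twin W K) (lvl_dvd_sq L) t →
        D.localTerm e hμ hadd₁ hadd₂ hgal (LocalInvariants.canonical ℚ (2 ^ L * 2 ^ L))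
          (Sum.inr (primesEquiv.symm ⟨ℓ, (hKol ℓ hℓ).1⟩)) ≠ 0 := by
  intro ℓ m' hℓ hsupp _hndvd heven j N a b t _ht _hz _hN _h2 _hAq hj hNM hNj hab hcm hbt D hD₁ hDt
  have hℓp : ℓ.Prime := (hKol ℓ hℓ).1
  haveI : Fact ℓ.Prime := ⟨hℓp⟩
  haveI : NeZero (2 ^ L) := ⟨pow_ne_zero L two_ne_zero⟩
  haveI : NeZero (2 ^ L * 2 ^ L) := ⟨by positivity⟩
  have hjL : L ≤ j := by omega
  -- ### (Y) `2^{b+L} β'_ℓ ≠ 0`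
  have hY : ((2 : ℤ) ^ (b + L)) • D.β' (Sum.inr (primesEquiv.symm ⟨ℓ, hℓp⟩)) ≠ 0 := by
    intro h0
    apply hbt
    letI : Algebra ℚ (Place.Completion (Sum.inr (primesEquiv.symm ⟨ℓ, hℓp⟩) : Place ℚ)) :=
      Place.instAlgebraCompletion _
    -- `[m]_* (2^b β') = 0` by `ι_* ∘ [m]_* = m` and the injectivity of `ι_*` over `ℚ_ℓ`
    have h1 : galoisCohomology.map ((mulK (twin W K) (2 ^ L) (2 ^ L)).restrictField
        (Place.Completion (Sum.inr (primesEquiv.symm ⟨ℓ, hℓp⟩) : Place ℚ))) 1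
        (((2 : ℤ) ^ b) • D.β' (Sum.inr (primesEquiv.symm ⟨ℓ, hℓp⟩))) = 0 := by
      apply map_inclKD_restrictField_injective_twin_of_kolPrime hK hoddK hΔ (hKol ℓ hℓ)
      rw [map_zero, map_inclKD_map_mulK_restrictField, smul_smul,
        show (((2 ^ L : ℕ) : ℤ)) * (2 : ℤ) ^ b = (2 : ℤ) ^ (b + L) by push_cast; ring, h0]
    -- `res_ℓ (2^b b') = 0` at level `m`
    have h2 : galoisCohomology.res ((twin W K).torsionGaloisModule ((2 ^ L : ℕ) : ℤ))
        (Place.Completion (Sum.inr (primesEquiv.symm ⟨ℓ, hℓp⟩) : Place ℚ)) 1 (((2 : ℤ) ^ b) • D.b') = 0 := by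
      rw [map_zsmul, ← D.map_β' (Sum.inr (primesEquiv.symm ⟨ℓ, hℓp⟩)), ← map_zsmul]
      exact h1
    -- `res_ℓ (ι (2^b t)) = 0` at level `m²`
    have h3 : galoisCohomology.res ((twin W K).torsionGaloisModule ((2 ^ L * 2 ^ L : ℕ) : ℤ))
        (Place.Completion (Sum.inr (primesEquiv.symm ⟨ℓ, hℓp⟩) : Place ℚ)) 1
        (torsionH1OfDvd (twin W K) (lvl_dvd_sq L) (((2 : ℤ) ^ b) • t)) = 0 := by
      have e3 : torsionH1OfDvd (twin W K) (lvl_dvd_sq L) (((2 : ℤ) ^ b) • t) =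
          galoisCohomology.map (inclKD (twin W K) (2 ^ L) (2 ^ L)) 1 (((2 : ℤ) ^ b) • D.b') := by
        refine (map_zsmul _ _ _).trans (Eq.trans ?_ (map_zsmul _ _ _).symm)
        exact congrArg (fun z => ((2 : ℤ) ^ b) • z) hDt.symm
      rw [e3, galoisCohomology.res_map_one, h2, map_zero]
    have h4 : torsionH1OfDvd (twin W K) (lvl_dvd_sq L) (((2 : ℤ) ^ b) • t) ∈
        (twin W K).torsionLocalKer (Place.Completion (Sum.inr (primesEquiv.symm ⟨ℓ, hℓp⟩) : Place ℚ))
          ((2 ^ L * 2 ^ L : ℕ) : ℤ) :=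
      (@mem_torsionLocalKer_iff_res_eq_zero ℚ _ (twin W K)
        (Place.Completion (Sum.inr (primesEquiv.symm ⟨ℓ, hℓp⟩) : Place ℚ)) _ (Place.instAlgebraCompletion _) _ _
        (charZero_placeCompletion _) (2 ^ L * 2 ^ L) (NeZero.ne (2 ^ L * 2 ^ L)) _).mpr h3
    have h5 : ((2 : ℤ) ^ b) • t ∈
        (twin W K).torsionLocalKer (Place.Completion (Sum.inr (primesEquiv.symm ⟨ℓ, hℓp⟩) : Place ℚ))
          (lvl (L + L)) :=
      (torsionH1OfDvd_mem_torsionLocalKer_iff_of_eq (twin W K) _ (lvl_dvd_sq L) (lvl_add_eq_sq L) _).mp h4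
    exact (mem_a₂_iff hℓp _).mpr h5
  -- ### the exponents: `b + 1 ≤ L`, else (Y) contradicts `2^{2L} β' = 0`
  by_cases hbL : b + 1 ≤ L
  swap
  · exfalso
    apply hY
    have hkill : (2 ^ L * 2 ^ L) • D.β' (Sum.inr (primesEquiv.symm ⟨ℓ, hℓp⟩)) = 0 :=
      nsmul_continuousCohomology_one_eq_zero _ (2 ^ L * 2 ^ L)
        (fun P : geomTorsion (twin W K) ((2 ^ L * 2 ^ L : ℕ) : ℤ) => AddSubgroup.torsionBy.nsmul P) _
    have e1 : (2 : ℤ) ^ (b + L) = (2 : ℤ) ^ (b + L - (L + L)) * ((2 ^ L * 2 ^ L : ℕ) : ℤ) := by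
      rw [Nat.cast_mul, Nat.cast_pow, Nat.cast_ofNat, ← pow_add, ← pow_add]
      congr 1
      omega
    rw [e1, mul_smul, natCast_zsmul, hkill, smul_zero]
  -- ### (X) `2^{a+L-N} res_ℓ b₁ ∉ 𝓛_ℓ`, and the generic lemma
  refine localTerm_canonical_ne_zero_twin_of_kolPrime hK hoddK hΔ (hKol ℓ hℓ) (by omega) e hμ hadd₁ hadd₂ hgal halt
    hnondeg D
    (a := a + L - N) (b := b + L) ?_ hY (by omega)
  intro hmem
  apply hcm
  have epow : ((2 : ℤ) ^ (a + (j - N))) • c₂ (ℓ * m') =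
      ((2 : ℤ) ^ (a + L - N)) • (((2 : ℤ) ^ (j - L)) • c₂ (ℓ * m')) := by
    rw [smul_smul, ← pow_add (2 : ℤ) (a + L - N) (j - L), show a + L - N + (j - L) = a + (j - N) by omega]
  have h6 : torsionH1OfDvd (twin W K) (lvl_dvd_sq L) (((2 : ℤ) ^ (a + (j - N))) • c₂ (ℓ * m')) ∈
      selmerLocalKer (twin W K) ((primesEquiv.symm ⟨ℓ, hℓp⟩ : HeightOneSpectrum (𝓞 ℚ)).adicCompletion ℚ)
        ((2 ^ L * 2 ^ L : ℕ) : ℤ) := by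
    refine mem_selmerLocalKer_of_mem_kummerLocalConditionAt_res (twin W K) _ _ ?_
    rw [epow, map_zsmul (torsionH1OfDvd (twin W K) (lvl_dvd_sq L)) ((2 : ℤ) ^ (a + L - N)), ← hD₁]
    convert hmem using 1
    exact map_zsmul _ _ _
  have h7 : ((2 : ℤ) ^ (a + (j - N))) • c₂ (ℓ * m') ∈
      selmerLocalKer (twin W K) ((primesEquiv.symm ⟨ℓ, hℓp⟩ : HeightOneSpectrum (𝓞 ℚ)).adicCompletion ℚ)
        (lvl (L + L)) :=
    (torsionH1OfDvd_mem_selmerLocalKer_iff (twin W K) _ (lvl_dvd_sq L) _).mpr h6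
  have h8 : ((2 : ℤ) ^ (a + (j - N))) • c₂ (ℓ * m') ∈ loc₂ W K (L + L) (pl ℓ) := by
    rw [pl_of_prime hℓp]; exact h7
  exact (h44₁₂ ℓ m' hℓ hsupp heven (a + (j - N))).mp h8

/-- **McCallum's Prop. 4.7 for the member `E^{(d_K)}` of the `ℚ`-pair at `2`, depth parity generic**: `hV₂_of_localTerm_of_kol`
with `Odd |m|` (Lemma 4.3 for `c₂`) replaced by `Par₂ m`, `Even |m'|` by `Par₁ m'`, and `|ℓm'| = |m'| + 1` by the displayed
link `hPar`; proof verbatim otherwise. [cite: McCallumLMS1991, §4 Prop. 4.7, §5 Lemma 5.3, Thm. 5.4 (proof)] [cite: MilneADT2006, Ch. I §6, Prop. 6.9] -/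
theorem hV₂_of_localTerm_of_par {M₀ : ℕ} (c₁ : ℕ → galH1Torsion W (lvl (L + L)))
    (c₂ : ℕ → galH1Torsion (twin W K) (lvl (L + L))) (hK : IsImaginaryQuadratic K)
    (hoddK : Odd (NumberField.discr K)) (hΔ : W.Δ < 0)
    (hρ2 : W.HasSurjectiveModNGaloisRep 2) (hL : M₀ ≤ L)
    (Kol : ℕ → Prop) (hKol : ∀ ℓ, Kol ℓ → kolPrime W K (L + L) ℓ)
    (Par₁ Par₂ : ℕ → Prop)
    (hPar : ∀ ℓ m' : ℕ, Kol ℓ → KolSupp Kol (ℓ * m') → ¬ ℓ ∣ m' → Par₁ m' → Par₂ (ℓ * m'))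
    -- `Ш(E^{(d_K)}/ℚ)[2^{2L}] ⊆ Ш(E^{(d_K)}/ℚ)[2^L]` (Kolyvagin's annihilator, or FINITENESS with `L` large)
    (hkill : ∀ a ∈ (twin W K).sha, ((2 : ℤ) ^ (2 * L)) • a = 0 → ((2 : ℤ) ^ L) • a = 0)
    -- McCallum's Lemma 4.3 over `ℚ` for the classes of odd depth (finite places off the depth, infinite places)
    (loc_c₂_fin : ∀ m, KolSupp Kol m → Par₂ m →
      ∀ v : HeightOneSpectrum (𝓞 ℚ), (m : 𝓞 ℚ) ∉ v.asIdeal →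
        c₂ m ∈ selmerLocalKer (twin W K) (v.adicCompletion ℚ) (lvl (L + L)))
    (loc_c₂_inf : ∀ m, KolSupp Kol m → Par₂ m →
      ∀ w : InfinitePlace ℚ, c₂ m ∈ selmerLocalKer (twin W K) w.Completion (lvl (L + L)))
    -- the Cassels–Tate data for `E^{(d_K)}` at level `2^L`, auxiliary level `2^L · 2^L`
    (e : geomTorsion (twin W K) ((2 ^ L * 2 ^ L : ℕ) : ℤ) → geomTorsion (twin W K) ((2 ^ L * 2 ^ L : ℕ) : ℤ) →
      AlgebraicClosure ℚ)
    (hμ : ∀ S T, e S T ^ (2 ^ L * 2 ^ L) = 1)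
    (hadd₁ : ∀ S₁ S₂ T, e (S₁ + S₂) T = e S₁ T * e S₂ T)
    (hadd₂ : ∀ S T₁ T₂, e S (T₁ + T₂) = e S T₁ * e S T₂)
    (hgal : ∀ (σ : absoluteGaloisGroup ℚ) (S T : geomTorsion (twin W K) ((2 ^ L * 2 ^ L : ℕ) : ℤ)),
      σ • e S T = e (σ • S) (σ • T))
    (halt : ∀ T, e T T = 1) (inv : LocalInvariants ℚ (2 ^ L * 2 ^ L)) (hPT' : inv.SumInvLocalizationEqZero)
    (hH3 : ∀ c : galoisCohomology (mu ℚ (2 ^ L * 2 ^ L)) 3,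
      (∀ v : Place ℚ, galoisCohomology.localization (mu ℚ (2 ^ L * 2 ^ L)) v 3 c = 0) → c = 0)
    (ι₂ : selmerGroup (twin W K) (lvl (L + L)) →+ ((twin W K).sha)[(2 ^ L : ℕ)])
    (hι₂ : ∀ z, shaTorsionVal (twin W K) (2 ^ L) (ι₂ z) = torsionH1ToH1 (twin W K) (lvl (L + L)) z)
    -- McCallum's Lemma 5.3 for the local term at `λ`, in the tree's cochain currency (displayed)
    (hloc₂ : ∀ ℓ m' : ℕ, (hℓ : Kol ℓ) → KolSupp Kol (ℓ * m') → ¬ ℓ ∣ m' →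
      Par₁ m' →
      ∀ (j N a b : ℕ) (t : galH1Torsion (twin W K) (lvl (L + L))), t ∈ selmerGroup (twin W K) (lvl (L + L)) →
      ((2 : ℤ) ^ j) • c₂ (ℓ * m') ∈ selmerGroup (twin W K) (lvl (L + L)) →
      ((2 : ℤ) ^ N) • t = 0 → ((2 : ℤ) ^ L) • t = 0 →
      (∀ q ∈ m'.primeFactors, t ∈ a₂ W K (L + L) q) → L + L - M₀ ≤ j → N + M₀ ≤ L + L → N ≤ j →
      a + b + 1 = N → ((2 : ℤ) ^ (a + (j - N))) • c₁ m' ∉ a₁ W (L + L) ℓ →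
      ((2 : ℤ) ^ b) • t ∉ a₂ W K (L + L) ℓ →
      ∀ D : FirstCaseData (twin W K) (2 ^ L),
        D.b₁ = torsionH1OfDvd (twin W K) (lvl_dvd_sq L) (((2 : ℤ) ^ (j - L)) • c₂ (ℓ * m')) →
        galoisCohomology.map (inclKD (twin W K) (2 ^ L) (2 ^ L)) 1 D.b' =
          torsionH1OfDvd (twin W K) (lvl_dvd_sq L) t →
        D.localTerm e hμ hadd₁ hadd₂ hgal inv (Sum.inr (primesEquiv.symm ⟨ℓ, (hKol ℓ hℓ).1⟩)) ≠ 0) :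
    ∀ ℓ m' : ℕ, Kol ℓ → KolSupp Kol (ℓ * m') → ¬ ℓ ∣ m' →
      Par₁ m' →
      ∀ (j N a b : ℕ) (t : galH1Torsion (twin W K) (lvl (L + L))) (ht : t ∈ selmerGroup (twin W K) (lvl (L + L)))
        (hz : ((2 : ℤ) ^ j) • c₂ (ℓ * m') ∈ selmerGroup (twin W K) (lvl (L + L))),
      ((2 : ℤ) ^ N) • t = 0 → ((2 : ℤ) ^ L) • t = 0 →
      (∀ q ∈ m'.primeFactors, t ∈ a₂ W K (L + L) q) → L + L - M₀ ≤ j →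
      N + M₀ ≤ L + L → N ≤ j → a + b + 1 = N →
      ((2 : ℤ) ^ (a + (j - N))) • c₁ m' ∉ a₁ W (L + L) ℓ →
      ((2 : ℤ) ^ b) • t ∉ a₂ W K (L + L) ℓ →
      ((ctLevelPairing (twin W K) (2 ^ L) e hμ hadd₁ hadd₂ hgal inv halt hPT' hH3
        (localTerm_finite_support (W := twin W K) (m := 2 ^ L) (e := e) (hμ := hμ) (hadd₁ := hadd₁)
          (hadd₂ := hadd₂) (hgal := hgal) halt inv)).comp ι₂).compl₂ ι₂ ⟨_, hz⟩ ⟨t, ht⟩ ≠ 0 := by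
  intro ℓ m' hℓ hsupp hndvd hodd j N a b t ht hz hN h2 hAq hj hNM hNj hab hcm hbt
  have ht2 : t ∈ selmerGroup (twin W K) (lvl (L + L)) := ht
  have hz2 : ((2 : ℤ) ^ j) • c₂ (ℓ * m') ∈ selmerGroup (twin W K) (lvl (L + L)) := hz
  have hN2 : ((2 : ℤ) ^ N) • t = 0 := hN
  have h22 : ((2 : ℤ) ^ L) • t = 0 := h2
  have hAq2 : ∀ q ∈ m'.primeFactors, t ∈ a₂ W K (L + L) q := hAq
  have hj2 : L + L - M₀ ≤ j := hj
  have hNM2 : N + M₀ ≤ L + L := hNM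
  have hcm2 : ((2 : ℤ) ^ (a + (j - N))) • c₁ m' ∉ a₁ W (L + L) ℓ := hcm
  have hbt2 : ((2 : ℤ) ^ b) • t ∉ a₂ W K (L + L) ℓ := hbt
  have hℓp : ℓ.Prime := (hKol ℓ hℓ).1
  haveI : NeZero (2 ^ L) := ⟨pow_ne_zero L two_ne_zero⟩
  have hΔ : W.Δ < 0 := hΔ
  have hjL : L ≤ j := by omega
  have hodd' : Par₂ (ℓ * m') := hPar ℓ m' hℓ hsupp hndvd hodd
  set v₀ : HeightOneSpectrum (𝓞 ℚ) := primesEquiv.symm ⟨ℓ, hℓp⟩ with hv₀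
  -- unfold the pulled-back pairing
  change ctLevelPairing (twin W K) (2 ^ L) e hμ hadd₁ hadd₂ hgal inv halt hPT' hH3
    (localTerm_finite_support (W := twin W K) (m := 2 ^ L) (e := e) (hμ := hμ) (hadd₁ := hadd₁) (hadd₂ := hadd₂)
      (hgal := hgal) halt inv) (ι₂ ⟨_, hz⟩) (ι₂ ⟨t, ht⟩) ≠ 0
  -- the map `ι'` at level `2^L · 2^L`
  have hsha : ∀ c ∈ (twin W K).sha, ((2 : ℤ) ^ (2 * L)) • c = 0 → ((2 : ℤ) ^ L) • c = 0 :=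
    hkill
  have hL' : ∀ c ∈ (twin W K).sha, (((2 ^ L * 2 ^ L : ℕ) : ℤ)) • c = 0 → ((2 ^ L : ℕ) : ℤ) • c = 0 := by
    intro c hc h0
    rw [Nat.cast_pow, Nat.cast_ofNat]
    refine hsha c hc ?_
    rwa [Nat.cast_mul, Nat.cast_pow, Nat.cast_ofNat, ← pow_add, ← two_mul] at h0
  obtain ⟨ι', hι'⟩ := exists_selmerToShaTorsion (twin W K) (2 ^ L) hL'
  -- transport to the level `2^L · 2^L`
  have hzτ : torsionH1OfDvd (twin W K) (lvl_dvd_sq L) (((2 : ℤ) ^ j) • c₂ (ℓ * m')) ∈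
      selmerGroup (twin W K) ((2 ^ L * 2 ^ L : ℕ) : ℤ) := torsionH1OfDvd_mem_selmerGroup (twin W K) _ hz2
  have htτ : torsionH1OfDvd (twin W K) (lvl_dvd_sq L) t ∈ selmerGroup (twin W K) ((2 ^ L * 2 ^ L : ℕ) : ℤ) :=
    torsionH1OfDvd_mem_selmerGroup (twin W K) _ ht2
  have hιz : ι₂ ⟨_, hz⟩ = ι' ⟨torsionH1OfDvd (twin W K) (lvl_dvd_sq L) (((2 : ℤ) ^ j) • c₂ (ℓ * m')), hzτ⟩ :=
    Subtype.ext (Subtype.ext (by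
      change shaTorsionVal (twin W K) (2 ^ L) (ι₂ ⟨_, hz⟩) = shaTorsionVal (twin W K) (2 ^ L) (ι' ⟨_, hzτ⟩)
      rw [hι₂, hι', torsionH1ToH1_torsionH1OfDvd]))
  have hιt : ι₂ ⟨t, ht⟩ = ι' ⟨torsionH1OfDvd (twin W K) (lvl_dvd_sq L) t, htτ⟩ :=
    Subtype.ext (Subtype.ext (by
      change shaTorsionVal (twin W K) (2 ^ L) (ι₂ ⟨t, ht⟩) = shaTorsionVal (twin W K) (2 ^ L) (ι' ⟨_, htτ⟩)
      rw [hι₂, hι', torsionH1ToH1_torsionH1OfDvd]))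
  rw [hιz, hιt]
  -- `z' = 2^L • b₁`
  have hz' : ((⟨torsionH1OfDvd (twin W K) (lvl_dvd_sq L) (((2 : ℤ) ^ j) • c₂ (ℓ * m')), hzτ⟩ :
      selmerGroup (twin W K) ((2 ^ L * 2 ^ L : ℕ) : ℤ)) : galH1Torsion (twin W K) ((2 ^ L * 2 ^ L : ℕ) : ℤ)) =
      ((2 ^ L : ℕ) : ℤ) • torsionH1OfDvd (twin W K) (lvl_dvd_sq L) (((2 : ℤ) ^ (j - L)) • c₂ (ℓ * m')) := by
    change torsionH1OfDvd (twin W K) (lvl_dvd_sq L) (((2 : ℤ) ^ j) • c₂ (ℓ * m')) = _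
    rw [← map_zsmul, zsmul_pow_sub_eq hjL]
  -- first-case data: `[2^L]_* t' = 0` (`2^L t = 0` displayed, `E(ℚ) ∩ E[2^L] = 0`)
  have hd : ((NumberField.discr K : ℤ) : ℚ) ≠ 0 := by exact_mod_cast NumberField.discr_ne_zero K
  have hρ2' : (twin W K).HasSurjectiveModNGaloisRep 2 :=
    (hasSurjectiveModNGaloisRep_two_quadraticTwist_iff W hd).mpr hρ2
  have h2W := DokchitserDokchitser2012.forall_two_nsmul_of_hasSurjectiveModNGaloisRep_two (twin W K)
    two_ne_zero hρ2'
  have hfix : ∀ P : geomTorsion (twin W K) ((2 ^ L : ℕ) : ℤ),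
      (∀ σ : absoluteGaloisGroup ℚ, σ • P = P) → P = 0 :=
    geomTorsion_fixed_eq_zero_of_forall_two_nsmul (twin W K) h2W L
  have h2L : ((2 ^ L : ℕ) : ℤ) • t = 0 := by
    rw [Nat.cast_pow, Nat.cast_ofNat]
    exact h22
  have hmt : ((2 ^ L : ℕ) : ℤ) • torsionH1OfDvd (twin W K) (lvl_dvd_sq L) t = 0 := by
    rw [← map_zsmul, h2L, map_zero]
  have hb₁ : ((2 ^ L : ℕ) : ℤ) • torsionH1OfDvd (twin W K) (lvl_dvd_sq L) (((2 : ℤ) ^ (j - L)) • c₂ (ℓ * m')) ∈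
      selmerGroup (twin W K) ((2 ^ L * 2 ^ L : ℕ) : ℤ) := by
    rw [← map_zsmul, zsmul_pow_sub_eq hjL]; exact hzτ
  obtain ⟨D, hD₁, hDt⟩ := exists_firstCaseData_of_zsmul_of_map_mulK_eq_zero (twin W K) (2 ^ L) hb₁ htτ
    (map_mulK_eq_zero_of_zsmul_eq_zero (twin W K) (2 ^ L) hfix hmt)
  rw [ctLevelPairing_pullback_ne_zero_iff_localTerm e hμ hadd₁ hadd₂ hgal inv halt hPT' hH3 _ ι' hι'
    ⟨_, hzτ⟩ ⟨_, htτ⟩ hz' D hD₁ hDt (Sum.inr v₀) ?_]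
  · exact hloc₂ ℓ m' hℓ hsupp hndvd hodd j N a b t ht2 hz2 hN2 h22 hAq2 hj2 hNM2 hNj hab hcm2 hbt2 D hD₁ hDt
  -- ### the places `v ≠ v_ℓ`
  intro v hv
  rcases v with w | v'
  · -- an infinite place: Lemma 4.3 at `∞`
    left
    have hc : c₂ (ℓ * m') ∈ selmerLocalKer (twin W K) (Place.Completion (Sum.inl w : Place ℚ)) (lvl (L + L)) :=
      loc_c₂_inf (ℓ * m') hsupp hodd' w
    have hc' := (torsionH1OfDvd_mem_selmerLocalKer_iff (twin W K) (Place.Completion (Sum.inl w : Place ℚ))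
      (lvl_dvd_sq L) _).mp hc
    have key := mem_kummerLocalConditionAt_res_of_mem_selmerLocalKer (twin W K) _ _ hc'
    rw [map_zsmul]
    convert AddSubgroup.zsmul_mem _ key ((2 : ℤ) ^ (j - L)) using 1
    exact map_zsmul _ _ _
  · by_cases hdiv : ((ℓ * m' : ℕ) : 𝓞 ℚ) ∈ v'.asIdeal
    · -- a place of `ℓ m'` other than `v_ℓ`: a place `v_q`, `q ∣ m'`
      right
      have hm' : ((m' : ℕ) : 𝓞 ℚ) ∈ v'.asIdeal := by
        rcases natCast_mem_or_natCast_mem_of_mul_mem hdiv with h1 | h1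
        · exact absurd ((natCast_prime_mem_iff_eq hℓp v').mp h1) (fun h ↦ hv (by rw [h]))
        · exact h1
      -- a prime factor `q` of `m'` with `q ∈ v'`
      obtain ⟨hsqm', hkolm'⟩ : KolSupp Kol m' := by
        have hmem : ℓ ∈ (ℓ * m').primeFactors :=
          Nat.mem_primeFactors.mpr ⟨hℓp, dvd_mul_right ℓ m', hsupp.1.ne_zero⟩
        obtain ⟨h, -⟩ := kolSupp_div hsupp hmem
        rwa [Nat.mul_div_cancel_left m' hℓp.pos] at h
      haveI := v'.isPrime
      have hprod : ((∏ q ∈ m'.primeFactors, q : ℕ) : 𝓞 ℚ) ∈ v'.asIdeal := by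
        rwa [Nat.prod_primeFactors_of_squarefree hsqm']
      rw [Nat.cast_prod] at hprod
      obtain ⟨q, hq, hqv⟩ := Ideal.IsPrime.prod_mem_iff.mp hprod
      have hqp : q.Prime := Nat.prime_of_mem_primeFactors hq
      have hkq : kolPrime W K (L + L) q := hKol q (hkolm' q hq)
      have hv'eq : v' = primesEquiv.symm ⟨q, hqp⟩ := (natCast_prime_mem_iff_eq hqp v').mp hqv
      subst hv'eq
      refine ⟨?_, map_inclKD_restrictField_injective_twin_of_kolPrime hK hoddK hΔ hkq⟩
      -- `loc_q t' = 0`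
      have htq : t ∈ (twin W K).torsionLocalKer
          ((primesEquiv.symm ⟨q, hqp⟩ : HeightOneSpectrum (𝓞 ℚ)).adicCompletion ℚ) (lvl (L + L)) :=
        (mem_a₂_iff hqp t).mp (hAq2 q hq)
      have htq' := torsionH1OfDvd_mem_torsionLocalKer (twin W K)
        (Place.Completion (Sum.inr (primesEquiv.symm ⟨q, hqp⟩) : Place ℚ)) (lvl_dvd_sq L) htq
      -- (`CharZero ℚ_q` passed explicitly: as an instance it would let `DivisionRing.toRatAlgebra` compete with
      -- `Place.instAlgebraCompletion`)
      exact (@mem_torsionLocalKer_iff_res_eq_zero ℚ _ (twin W K)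
        (Place.Completion (Sum.inr (primesEquiv.symm ⟨q, hqp⟩) : Place ℚ)) _ (Place.instAlgebraCompletion _) _ _
        (charZero_placeCompletion _) (2 ^ L * 2 ^ L) (NeZero.ne (2 ^ L * 2 ^ L)) _).mp htq'
    · -- a finite place not dividing `ℓ m'`: Lemma 4.3 over `ℚ`
      left
      have hc : c₂ (ℓ * m') ∈ selmerLocalKer (twin W K) (Place.Completion (Sum.inr v' : Place ℚ))
          (lvl (L + L)) := loc_c₂_fin (ℓ * m') hsupp hodd' v' hdiv
      have hc' := (torsionH1OfDvd_mem_selmerLocalKer_iff (twin W K) (Place.Completion (Sum.inr v' : Place ℚ))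
        (lvl_dvd_sq L) _).mp hc
      have key := mem_kummerLocalConditionAt_res_of_mem_selmerLocalKer (twin W K) _ _ hc'
      rw [map_zsmul]
      convert AddSubgroup.zsmul_mem _ key ((2 : ℤ) ^ (j - L)) using 1
      exact map_zsmul _ _ _

/-- **The member formula `hV₂` for THE Cassels–Tate pairing of `E^{(d_K)}` at level `2^L`, depth parity generic**:
`hV₂_of_localTerm_of_par` ∘ `hloc₂_canonical_of_rel_of_par` with Tate's reciprocity and `Ш³(ℚ, μ) = 0`
supplied (= `hV₂_canonical_of_kol` for `(Par₁, Par₂) = (Even, Odd)`; the branch `ε(E/ℚ) = +1` takes `(Odd, Even)`).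
[cite: McCallumLMS1991, §4 Prop. 4.7, §5 Lemma 5.3, Thm. 5.4 (proof)] [cite: MilneADT2006, Ch. I Thm. 4.10 and §6 Prop. 6.9] -/
theorem hV₂_canonical_of_par [NeZero (2 ^ L * 2 ^ L)] {M₀ : ℕ} (c₁ : ℕ → galH1Torsion W (lvl (L + L)))
    (c₂ : ℕ → galH1Torsion (twin W K) (lvl (L + L))) (hK : IsImaginaryQuadratic K)
    (hoddK : Odd (NumberField.discr K)) (hΔ : W.Δ < 0)
    (hρ2 : W.HasSurjectiveModNGaloisRep 2) (hL : M₀ ≤ L) (hL1 : 1 ≤ L)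
    (Kol : ℕ → Prop) (hKol : ∀ ℓ, Kol ℓ → kolPrime W K (L + L) ℓ)
    (Par₁ Par₂ : ℕ → Prop)
    (hPar : ∀ ℓ m' : ℕ, Kol ℓ → KolSupp Kol (ℓ * m') → ¬ ℓ ∣ m' → Par₁ m' → Par₂ (ℓ * m'))
    (hkill : ∀ a ∈ (twin W K).sha, ((2 : ℤ) ^ (2 * L)) • a = 0 → ((2 : ℤ) ^ L) • a = 0)
    (loc_c₂_fin : ∀ m, KolSupp Kol m → Par₂ m →
      ∀ v : HeightOneSpectrum (𝓞 ℚ), (m : 𝓞 ℚ) ∉ v.asIdeal →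
        c₂ m ∈ selmerLocalKer (twin W K) (v.adicCompletion ℚ) (lvl (L + L)))
    (loc_c₂_inf : ∀ m, KolSupp Kol m → Par₂ m →
      ∀ w : InfinitePlace ℚ, c₂ m ∈ selmerLocalKer (twin W K) w.Completion (lvl (L + L)))
    (h44₁₂ : ∀ ℓ m : ℕ, Kol ℓ → KolSupp Kol (ℓ * m) →
      Par₁ m → ∀ a : ℕ,
        ((2 : ℤ) ^ a) • c₂ (ℓ * m) ∈ loc₂ W K (L + L) (pl ℓ) ↔ ((2 : ℤ) ^ a) • c₁ m ∈ a₁ W (L + L) ℓ)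
    (e : geomTorsion (twin W K) ((2 ^ L * 2 ^ L : ℕ) : ℤ) → geomTorsion (twin W K) ((2 ^ L * 2 ^ L : ℕ) : ℤ) →
      AlgebraicClosure ℚ)
    (hμ : ∀ S T, e S T ^ (2 ^ L * 2 ^ L) = 1)
    (hadd₁ : ∀ S₁ S₂ T, e (S₁ + S₂) T = e S₁ T * e S₂ T)
    (hadd₂ : ∀ S T₁ T₂, e S (T₁ + T₂) = e S T₁ * e S T₂)
    (hgal : ∀ (σ : absoluteGaloisGroup ℚ) (S T : geomTorsion (twin W K) ((2 ^ L * 2 ^ L : ℕ) : ℤ)),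
      σ • e S T = e (σ • S) (σ • T))
    (halt : ∀ T, e T T = 1) (hnondeg : ∀ T, (∀ S, e S T = 1) → T = 0)
    (ι₂ : selmerGroup (twin W K) (lvl (L + L)) →+ ((twin W K).sha)[(2 ^ L : ℕ)])
    (hι₂ : ∀ z, shaTorsionVal (twin W K) (2 ^ L) (ι₂ z) = torsionH1ToH1 (twin W K) (lvl (L + L)) z) :
    ∀ ℓ m' : ℕ, Kol ℓ → KolSupp Kol (ℓ * m') → ¬ ℓ ∣ m' →
      Par₁ m' →
      ∀ (j N a b : ℕ) (t : galH1Torsion (twin W K) (lvl (L + L))) (ht : t ∈ selmerGroup (twin W K) (lvl (L + L)))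
        (hz : ((2 : ℤ) ^ j) • c₂ (ℓ * m') ∈ selmerGroup (twin W K) (lvl (L + L))),
      ((2 : ℤ) ^ N) • t = 0 → ((2 : ℤ) ^ L) • t = 0 →
      (∀ q ∈ m'.primeFactors, t ∈ a₂ W K (L + L) q) → L + L - M₀ ≤ j →
      N + M₀ ≤ L + L → N ≤ j → a + b + 1 = N →
      ((2 : ℤ) ^ (a + (j - N))) • c₁ m' ∉ a₁ W (L + L) ℓ →
      ((2 : ℤ) ^ b) • t ∉ a₂ W K (L + L) ℓ →
      ((ctLevelPairing (twin W K) (2 ^ L) e hμ hadd₁ hadd₂ hgal (LocalInvariants.canonical ℚ (2 ^ L * 2 ^ L)) halt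
        (sumInvLocalizationEqZero_canonical_of_numberField ℚ (2 ^ L * 2 ^ L)) (shaThree_mu_eq_zero ℚ (2 ^ L * 2 ^ L))
        (localTerm_finite_support (W := twin W K) (m := 2 ^ L) (e := e) (hμ := hμ) (hadd₁ := hadd₁)
          (hadd₂ := hadd₂) (hgal := hgal) halt (LocalInvariants.canonical ℚ (2 ^ L * 2 ^ L)))).comp ι₂).compl₂ ι₂ ⟨_, hz⟩ ⟨t, ht⟩ ≠ 0 := by
  exact hV₂_of_localTerm_of_par c₁ c₂ hK hoddK hΔ hρ2 hL Kol hKol Par₁ Par₂ hPar hkill loc_c₂_fin loc_c₂_inf e hμ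
    hadd₁ hadd₂ hgal halt
    (LocalInvariants.canonical ℚ (2 ^ L * 2 ^ L))
    (sumInvLocalizationEqZero_canonical_of_numberField ℚ (2 ^ L * 2 ^ L))
    (shaThree_mu_eq_zero ℚ (2 ^ L * 2 ^ L)) ι₂ hι₂
    (hloc₂_canonical_of_rel_of_par c₁ c₂ hK hoddK hΔ hL hL1 Kol hKol Par₁ h44₁₂ e hμ hadd₁ hadd₂ hgal halt
      hnondeg)

end ParMemberTwo

end Summit.BirchSwinnertonDyer.BirchSwinnertonDyer.Theorems.KolyvaginPairDataTwo

end
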